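import Mathlib

/-!
# Route `UniversalDetector`, support item `LimitExtraction` (stmt-QuantumFields-26597): calculus of mesh limits

Ideator seat ym-idea-8 g4.  Companion to `UniversalDetectorMeshArzelaAscoli.lean` (`meshArzelaAscoli`): once a
subsequence `φ` and a kernel `K` with annulus-uniform approximation along the meshes and continuity off the origin
are extracted, (1) `exists_meshSeq_tendsto` — every point is a limit of mesh points `zs k ∈ S (φ k)` (density of the
meshes); (2) `tendsto_meshValues` — along any such sequence `zs k → x ≠ 0` the values `f (φ k) (zs k)` converge to
`K x`; (3) `meshLimit_invariant` — an (eventual) invariance of the meshes and of `f (φ k)` under a map `σ` continuous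
at `x` passes to the limit: `K (σ x) = K x`.  With `σ = -id`, `σ = timeReflection 4`, `σ =` a coordinate permutation
this gives the evenness / ϑ-invariance / permutation-invariance conclusions of `LimitExtraction` from the exact
lattice symmetries of the rescaled kernels; (2) is the evaluation rule used when passing reflection positivity and
the `Q2` Riemann sums to the limit.  Mathlib only; no lattice gauge theory enters; no summit, leg or spine statement
is proved here.
-/

set_option autoImplicit false

namespace Summit.QuantumFields.YangMills.Cruxes.UniversalDetectorLimitExtraction

open Filter Topology Set Metric

/-- **Mesh points converging to any point.**  If the meshes `S k` become dense in every ball, then along any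
subsequence `φ` every point `x` is the limit of a sequence of mesh points `zs k ∈ S (φ k)` (eventually). -/
theorem exists_meshSeq_tendsto (d : ℕ) (S : ℕ → Set (EuclideanSpace ℝ (Fin d)))
    (hD : ∀ δ R : ℝ, 0 < δ → 0 < R → ∃ k₀ : ℕ, ∀ k, k₀ ≤ k →
      ∀ x : EuclideanSpace ℝ (Fin d), ‖x‖ ≤ R → ∃ z ∈ S k, ‖x - z‖ ≤ δ)
    (φ : ℕ → ℕ) (hφ : StrictMono φ) (x : EuclideanSpace ℝ (Fin d)) :
    ∃ zs : ℕ → EuclideanSpace ℝ (Fin d), (∀ᶠ k in atTop, zs k ∈ S (φ k)) ∧ Tendsto zs atTop (𝓝 x) := by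
  classical
  -- nearly-nearest mesh points
  have hz : ∀ k : ℕ, ∃ z : EuclideanSpace ℝ (Fin d),
      (S (φ k)).Nonempty → z ∈ S (φ k) ∧ dist x z < infDist x (S (φ k)) + 1 / ((k : ℝ) + 1) := by
    intro k
    by_cases hne : (S (φ k)).Nonempty
    · have hpos : (0 : ℝ) < 1 / ((k : ℝ) + 1) := by positivity
      obtain ⟨z, hzS, hzd⟩ := (infDist_lt_iff hne).mp (lt_add_of_pos_right (infDist x (S (φ k))) hpos)
      exact ⟨z, fun _ => ⟨hzS, hzd⟩⟩
    · exact ⟨x, fun h => absurd h hne⟩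
  choose zs hzs using hz
  have hnear : ∀ δ : ℝ, 0 < δ → ∃ k₁ : ℕ, ∀ k, k₁ ≤ k → zs k ∈ S (φ k) ∧ dist x (zs k) < δ := by
    intro δ hδ
    obtain ⟨k₀, hk₀⟩ := hD (δ / 2) (max ‖x‖ 1) (by positivity) (by positivity)
    obtain ⟨k₁, hk₁⟩ := exists_nat_one_div_lt (by positivity : 0 < δ / 2)
    refine ⟨max k₀ k₁, fun k hk => ?_⟩
    have hkφ : k₀ ≤ φ k := ((le_max_left _ _).trans hk).trans (hφ.id_le k)
    obtain ⟨z, hzS, hzx⟩ := hk₀ (φ k) hkφ x (le_max_left _ _)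
    obtain ⟨hmem, hdist⟩ := hzs k ⟨z, hzS⟩
    refine ⟨hmem, ?_⟩
    have h1 : infDist x (S (φ k)) ≤ δ / 2 := (infDist_le_dist_of_mem hzS).trans (by rwa [dist_eq_norm])
    have h2 : 1 / ((k : ℝ) + 1) ≤ 1 / ((k₁ : ℝ) + 1) := by
      gcongr; exact_mod_cast (le_max_right _ _).trans hk
    linarith
  refine ⟨zs, ?_, ?_⟩
  · obtain ⟨k₁, hk₁⟩ := hnear 1 one_pos
    filter_upwards [eventually_ge_atTop k₁] with k hk using (hk₁ k hk).1
  · refine Metric.tendsto_nhds.mpr fun ε hε => ?_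
    obtain ⟨k₁, hk₁⟩ := hnear ε hε
    filter_upwards [eventually_ge_atTop k₁] with k hk
    rw [dist_comm]; exact (hk₁ k hk).2

/-- **Evaluation of the mesh limit.**  Under the conclusions of `meshArzelaAscoli` (annulus-uniform approximation
along the meshes and continuity of `K` off the origin), the values `f (φ k) (zs k)` along ANY sequence of mesh points
`zs k → x ≠ 0` converge to `K x`. -/
theorem tendsto_meshValues (d : ℕ) (S : ℕ → Set (EuclideanSpace ℝ (Fin d)))
    (f : ℕ → EuclideanSpace ℝ (Fin d) → ℝ) (φ : ℕ → ℕ) (K : EuclideanSpace ℝ (Fin d) → ℝ)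
    (happrox : ∀ η ε : ℝ, 0 < η → 0 < ε → ∃ k₀ : ℕ, ∀ k, k₀ ≤ k → ∀ z ∈ S (φ k), η ≤ ‖z‖ → ‖z‖ ≤ η⁻¹ →
      |f (φ k) z - K z| ≤ ε)
    (hcont : ContinuousOn K {z | z ≠ 0})
    (x : EuclideanSpace ℝ (Fin d)) (hx : x ≠ 0) (zs : ℕ → EuclideanSpace ℝ (Fin d))
    (hzS : ∀ᶠ k in atTop, zs k ∈ S (φ k)) (hzx : Tendsto zs atTop (𝓝 x)) :
    Tendsto (fun k => f (φ k) (zs k)) atTop (𝓝 (K x)) := by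
  have hxpos : 0 < ‖x‖ := norm_pos_iff.mpr hx
  -- an annulus containing a neighbourhood of `x`
  set η : ℝ := min (‖x‖ / 2) (1 / (2 * ‖x‖)) with hη_def
  have hη : 0 < η := by positivity
  have hη1 : η ≤ ‖x‖ / 2 := min_le_left _ _
  have hη2 : η ≤ 1 / (2 * ‖x‖) := min_le_right _ _
  have hKz : Tendsto (fun k => K (zs k)) atTop (𝓝 (K x)) :=
    (hcont.continuousAt (isOpen_ne.mem_nhds hx)).tendsto.comp hzx
  have hdiff : Tendsto (fun k => f (φ k) (zs k) - K (zs k)) atTop (𝓝 0) := by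
    refine Metric.tendsto_nhds.mpr fun ε hε => ?_
    obtain ⟨k₀, hk₀⟩ := happrox η (ε / 2) hη (half_pos hε)
    have hclose : ∀ᶠ k in atTop, dist (zs k) x < ‖x‖ / 2 := Metric.tendsto_nhds.mp hzx _ (half_pos hxpos)
    filter_upwards [hzS, hclose, eventually_ge_atTop k₀] with k hkS hkx hk0
    rw [dist_eq_norm] at hkx
    have hlow : ‖x‖ / 2 ≤ ‖zs k‖ := by
      have h1 := norm_sub_norm_le x (zs k); rw [norm_sub_rev] at h1; linarith
    have hup : ‖zs k‖ ≤ 2 * ‖x‖ := by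
      have h1 := norm_le_norm_add_norm_sub' (zs k) x
      have h2 : ‖zs k - x‖ < ‖x‖ / 2 := hkx
      linarith [norm_add_le (zs k - x) x]
    have hup' : ‖zs k‖ ≤ η⁻¹ := by
      rw [le_inv_comm₀ (by linarith) hη]
      calc η ≤ 1 / (2 * ‖x‖) := hη2
        _ ≤ (‖zs k‖)⁻¹ := by rw [one_div]; exact inv_anti₀ (by linarith) hup
    have := hk₀ k hk0 (zs k) hkS (hη1.trans hlow) hup'
    rw [Real.dist_eq, sub_zero]
    exact this.trans_lt (half_lt_self hε)
  have := hdiff.add hKz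
  simpa using this

/-- **Mesh invariances pass to the limit.**  If (eventually in `k`) the mesh `S (φ k)` is stable under a map `σ` and
`f (φ k)` is `σ`-invariant on it, `σ` is continuous at `x`, and `x`, `σ x` are off the origin, then `K (σ x) = K x`
(used for evenness, time-reflection and coordinate-permutation invariance of the extracted kernel). -/
theorem meshLimit_invariant (d : ℕ) (S : ℕ → Set (EuclideanSpace ℝ (Fin d)))
    (f : ℕ → EuclideanSpace ℝ (Fin d) → ℝ) (φ : ℕ → ℕ) (hφ : StrictMono φ) (K : EuclideanSpace ℝ (Fin d) → ℝ)
    (hD : ∀ δ R : ℝ, 0 < δ → 0 < R → ∃ k₀ : ℕ, ∀ k, k₀ ≤ k →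
      ∀ x : EuclideanSpace ℝ (Fin d), ‖x‖ ≤ R → ∃ z ∈ S k, ‖x - z‖ ≤ δ)
    (happrox : ∀ η ε : ℝ, 0 < η → 0 < ε → ∃ k₀ : ℕ, ∀ k, k₀ ≤ k → ∀ z ∈ S (φ k), η ≤ ‖z‖ → ‖z‖ ≤ η⁻¹ →
      |f (φ k) z - K z| ≤ ε)
    (hcont : ContinuousOn K {z | z ≠ 0})
    (σ : EuclideanSpace ℝ (Fin d) → EuclideanSpace ℝ (Fin d))
    (hσS : ∀ᶠ k in atTop, ∀ z ∈ S (φ k), σ z ∈ S (φ k) ∧ f (φ k) (σ z) = f (φ k) z)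
    (x : EuclideanSpace ℝ (Fin d)) (hx : x ≠ 0) (hσx : σ x ≠ 0) (hσc : ContinuousAt σ x) :
    K (σ x) = K x := by
  obtain ⟨zs, hzS, hzx⟩ := exists_meshSeq_tendsto d S hD φ hφ x
  have h1 : Tendsto (fun k => f (φ k) (zs k)) atTop (𝓝 (K x)) :=
    tendsto_meshValues d S f φ K happrox hcont x hx zs hzS hzx
  have h2 : Tendsto (fun k => f (φ k) (σ (zs k))) atTop (𝓝 (K (σ x))) :=
    tendsto_meshValues d S f φ K happrox hcont (σ x) hσx (fun k => σ (zs k))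
      (by filter_upwards [hzS, hσS] with k hk hσ using (hσ _ hk).1) (hσc.tendsto.comp hzx)
  have h3 : (fun k => f (φ k) (σ (zs k))) =ᶠ[atTop] fun k => f (φ k) (zs k) := by
    filter_upwards [hzS, hσS] with k hk hσ using (hσ _ hk).2
  exact tendsto_nhds_unique (h2.congr' h3) h1

end Summit.QuantumFields.YangMills.Cruxes.UniversalDetectorLimitExtraction
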